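/-
Copyright (c) 2026. All rights reserved.
Released under Apache 2.0 license as described in the file LICENSE.
Authors: abc-iut cell, statement-typer seat abc-iut-L4-t9 (wave 2, block W2-B2).
-/
import Literature.AnabelianGeometry.AbsoluteAnabelian.AbsTopIII.BiAnabelianDiagrams

/-!
# [AbsTopIII] Corollary 3.7 (iii), (iv): the log-observable `𝔖†_log` and the first bi-anabelian
# log-Frobenius INCOMPATIBILITY

S. Mochizuki, *Topics in absolute anabelian geometry III: global reconstruction algorithms*,
J. Math. Sci. Univ. Tokyo 22 (2015) 939–1156 [MochizukiAbsTopIII2015]; locators = pages of the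
author's manuscript (`paper:url-5493eb38cbb7`; journal pagination not held), read on the page:
Cor 3.7 (ii)–(iv) pp. 87–88; the proof "entirely similar to" Cor 3.6's, pp. 80–82; Def 3.5 pp. 74–77.

Input `𝔖 : BiAnabelianSetting X E N` and the diagrams `𝒟*`, `𝒟†_{≤n}` of `BiAnabelianDiagrams.lean`.
Typed in the style of abc-iut-L4-t5's Cor 3.6 file (pinned shapes, generated-by + pinned
homotopies; components of pinned homotopies compared through `eqToHom` of object equalities that
hold by `rfl` here, `logPinned_objEqs`).

* (iii) `ObservableLogStmt`: "`ι_{log,⋎}`, `ι_×` belong to a family of homotopies on `𝒟†_{≤3}` that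
  determines on `𝒟†_{≤3}` a structure of observable `𝔖†_log` on `𝒟†_{≤2}`" — `𝒟†_{≤3}` presented as
  `𝒟†_{≤2}` extended by the observation vertex `𝒩` (`logObsDiagram`), generators `LogGen` (the type
  (1)/(2) pairs of the proof of Cor 3.6 (iii) p. 81 with `pr_⋎` for `id_⋎`), pinned by `LogPinned`.
* (iv) `IncompatibleStmt`: "`𝒟†_{≤2}` does not admit a structure of core on `𝒟†_{≤1}` which is
  compatible with the observable `𝔖†_log`" (t2/t5's reading, implying print: no family on `𝒟†_{≤3}`
  contains isomorphisms `ζ₀` for the pairs `([pr_{⋎+1}], [pr_⋎]∘[log_𝒳])` together with the pinned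
  `𝔖†_log` homotopies — whence the equation contradicting Lemma 3.4, cf.
  `BiAnabelianSetting.LogCoreKernel`). Item (ii) (telecore `𝔗_δ`, family `ℋ_δ`, `𝒟*` a core on
  `𝒟*_{≤3}`) and the SECOND incompatibility of (iv) are in `BiAnabelianTelecore.lean`.
* NOT typed (docstring, as in t5's Cor 3.6 file): the clause "compatible with the families of
  homotopies that constitute the core and telecore structures of (i), (ii)" of (iii) (transport of
  families along morphisms of graphs is not in the Def 3.5 files).

All statements are per-setting `Prop`s (FACT-policy: for the MLF setting they are [AbsTopIII]
Cor 3.7, "proofs entirely similar to the proofs of Corollary 3.6", p. 88). Refereed pre-IUT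
anabelian geometry; nothing here bears on [IUTchIII] Cor. 3.12; typed ≠ discharged.
-/

set_option autoImplicit false

namespace Literature.AnabelianGeometry.AbsoluteAnabelian.AbsTopIII

open CategoryTheory Quiver DiagramOfCategories

universe u

namespace BiAnabelianSetting

variable {X E N : Type u} [Category.{u} X] [Category.{u} E] [Category.{u} N]
  (𝔖 : BiAnabelianSetting X E N)

/-! ## Cor 3.7 (iii): the observable `𝔖†_log` on `𝒟†_{≤2}` -/

/-- Observation edges of the shape "append `𝒩` to `𝒟†_{≤2}`": the two edges `λ^×`, `λ^{×pf}` out of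
`□`. [cite: MochizukiAbsTopIII2015, Cor 3.7 (iii) p.88] -/
def logObsI : SubVertex {a : Cor37Vertex | a.InDaggerLe 2} → Type u
  | ⟨.box, _⟩ => ULift Bool
  | ⟨.first _, _⟩ => PEmpty
  | ⟨.space, _⟩ => PEmpty
  | ⟨.galois, _⟩ => PEmpty
  | ⟨.ref, _⟩ => PEmpty

/-- The shape "`𝒟†_{≤2}` extended by the observation vertex `𝒩`" (the extended diagram is `𝒟†_{≤3}`).
[cite: MochizukiAbsTopIII2015, Cor 3.7 (iii) p.88] -/
def logObsShape : ExtShape.{u} (SubVertex {a : Cor37Vertex | a.InDaggerLe 2}) where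
  I := logObsI.{u}
  J _ := PEmpty

/-- Extension data: `𝒩` at the observation vertex, `λ^×` (`true`) / `λ^{×pf}` (`false`) on the edges.
[cite: MochizukiAbsTopIII2015, Cor 3.7 (iii) p.88] -/
def logObsExt : (𝔖.daggerLe 2).ExtData logObsShape.{u} where
  S := N
  obsMap {a} i := match a, i with
    | ⟨.box, _⟩, i => if (ULift.down i : Bool) then 𝔖.lamTimes else 𝔖.lamTimesPf
    | ⟨.first _, _⟩, i => PEmpty.elim i
    | ⟨.space, _⟩, i => PEmpty.elim i
    | ⟨.galois, _⟩, i => PEmpty.elim i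
    | ⟨.ref, _⟩, i => PEmpty.elim i
  telMap j := PEmpty.elim j

/-- `𝒟†_{≤3}` presented as `𝒟†_{≤2}` extended by the observation vertex `𝒩`.
[cite: MochizukiAbsTopIII2015, Cor 3.7 (iii) p.88] -/
def logObsDiagram : DiagramOfCategories logObsShape.{u}.Vertex := (𝔖.daggerLe 2).extend 𝔖.logObsExt

section LogPaths

/-- The first-row vertex `⋎ = n` of `𝒟†_{≤3}`. [cite: MochizukiAbsTopIII2015, Cor 3.7 (iii) p.88] -/
def lvFirst (n : ℤ) : logObsShape.{u}.Vertex :=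
  logObsShape.{u}.base (dv 2 (.first n) (Cor37Vertex.first_inDaggerLe n (by decide)))

/-- The nexus `□` of `𝒟†_{≤3}`. [cite: MochizukiAbsTopIII2015, Cor 3.7 (iii) p.88] -/
def lvBox : logObsShape.{u}.Vertex := logObsShape.{u}.base (dv 2 .box (Cor37Vertex.box_inDaggerLe le_rfl))

/-- The observation vertex `𝒩`. [cite: MochizukiAbsTopIII2015, Cor 3.7 (iii) p.88] -/
def lvObs : logObsShape.{u}.Vertex := logObsShape.{u}.obs

/-- The edge `log_𝒳 : ⋎+1 → ⋎`. [cite: MochizukiAbsTopIII2015, Cor 3.7 (iii) p.88] -/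
def eLog (n : ℤ) : (lvFirst.{u} (n + 1) ⟶ lvFirst.{u} n) := Cor37Edge.log (n + 1) n rfl

/-- The edge `pr_⋎ : ⋎ → □`. [cite: MochizukiAbsTopIII2015, Cor 3.7 (iii) p.88] -/
def ePr (n : ℤ) : (lvFirst.{u} n ⟶ lvBox.{u}) := Cor37Edge.pr n

/-- The edge `λ^× : □ → 𝒩`. [cite: MochizukiAbsTopIII2015, Cor 3.7 (iii) p.88] -/
def eLamTimes : (lvBox.{u} ⟶ lvObs.{u}) := (⟨true⟩ : ULift Bool)

/-- The edge `λ^{×pf} : □ → 𝒩`. [cite: MochizukiAbsTopIII2015, Cor 3.7 (iii) p.88] -/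
def eLamPf : (lvBox.{u} ⟶ lvObs.{u}) := (⟨false⟩ : ULift Bool)

/-- `[λ^×] ∘ [pr_⋎] ∘ [log_𝒳]` from `⋎+1` (left path of the type-(1) pair, source of `ι_{log,⋎}`).
[cite: MochizukiAbsTopIII2015, Cor 3.7 (iii) p.88] -/
def logPairLeft (n : ℤ) : Path (lvFirst.{u} (n + 1)) lvObs.{u} :=
  (((Path.nil : Path (lvFirst.{u} (n + 1)) (lvFirst (n + 1))).cons (eLog n)).cons (ePr n)).cons
    eLamTimes

/-- `[λ^{×pf}] ∘ [pr_{⋎+1}]` from `⋎+1` (right path of the type-(1) pair).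
[cite: MochizukiAbsTopIII2015, Cor 3.7 (iii) p.88] -/
def logPairRight (n : ℤ) : Path (lvFirst.{u} (n + 1)) lvObs.{u} :=
  ((Path.nil : Path (lvFirst.{u} (n + 1)) (lvFirst (n + 1))).cons (ePr (n + 1))).cons eLamPf

/-- `[λ^×]` from `□` (left path of the type-(2) pair, source of `ι_×`).
[cite: MochizukiAbsTopIII2015, Cor 3.7 (iii) p.88] -/
def timesPairLeft : Path lvBox.{u} lvObs.{u} := (Path.nil : Path lvBox.{u} lvBox).cons eLamTimes

/-- `[λ^{×pf}]` from `□` (right path of the type-(2) pair). [cite: MochizukiAbsTopIII2015, Cor 3.7 (iii) p.88] -/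
def timesPairRight : Path lvBox.{u} lvObs.{u} := (Path.nil : Path lvBox.{u} lvBox).cons eLamPf

/-- `[pr_{⋎+1}]` (left path of the would-be core pair `ζ₀` of the proof of (iv), cf. p. 81).
[cite: MochizukiAbsTopIII2015, Cor 3.7 (iv) p.88] -/
def corePathPr (n : ℤ) : Path (lvFirst.{u} (n + 1)) lvBox.{u} :=
  (Path.nil : Path (lvFirst.{u} (n + 1)) (lvFirst (n + 1))).cons (ePr (n + 1))

/-- `[pr_⋎] ∘ [log_𝒳]` (right path of the would-be core pair). [cite: MochizukiAbsTopIII2015, Cor 3.7 (iv) p.88] -/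
def corePathLog (n : ℤ) : Path (lvFirst.{u} (n + 1)) lvBox.{u} :=
  ((Path.nil : Path (lvFirst.{u} (n + 1)) (lvFirst (n + 1))).cons (eLog n)).cons (ePr n)

end LogPaths

/-- The GENERATORS of the boundary set of `𝔖†_log`: type (1) `([λ^×]∘[pr_⋎]∘[log_𝒳], [λ^{×pf}]∘[pr_{⋎+1}])`
and type (2) `([λ^×], [λ^{×pf}])` (their pre-compositions and the reflexive pairs come from
saturation; proof of Cor 3.6 (iii) p. 81 read with `pr_⋎` for `id_⋎`).
[cite: MochizukiAbsTopIII2015, Cor 3.7 (iii) p.88] -/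
inductive LogGen : ∀ ⦃a b : logObsShape.{u}.Vertex⦄, Path a b → Path a b → Prop
  | type1 (n : ℤ) : LogGen (logPairLeft n) (logPairRight n)
  | type2 : LogGen timesPairLeft timesPairRight

/-- "`ι_{log,⋎}` (respectively, `ι_×`) determine(s) the homotopies for pairs of type (1) (respectively,
(2))": the family CONTAINS the generator pairs with exactly these natural transformations as
homotopies (`ι_{log,⋎}` at `(A₁, A₂, α)` is `ι_log` at `A₁ = pr(A₁, A₂, α)`).
[cite: MochizukiAbsTopIII2015, Cor 3.7 (iii) p.88] -/
def LogPinned (H : 𝔖.logObsDiagram.HomotopyFamily) : Prop :=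
  (∃ h : H.E timesPairLeft timesPairRight,
    ∀ (x : X) (e₁ : (𝔖.logObsDiagram.pathFunctor timesPairLeft).obj x = 𝔖.lamTimes.obj x)
      (e₂ : (𝔖.logObsDiagram.pathFunctor timesPairRight).obj x = 𝔖.lamTimesPf.obj x),
      (H.η h).app x = eqToHom e₁ ≫ 𝔖.iotaTimes.app x ≫ eqToHom e₂.symm) ∧
  ∀ n : ℤ, ∃ h : H.E (logPairLeft n) (logPairRight n),
    ∀ (o : 𝔖.Sq)
      (e₁ : (𝔖.logObsDiagram.pathFunctor (logPairLeft n)).obj o = 𝔖.lamTimes.obj (𝔖.log.obj o.fst))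
      (e₂ : (𝔖.logObsDiagram.pathFunctor (logPairRight n)).obj o = 𝔖.lamTimesPf.obj o.fst),
      (H.η h).app o = eqToHom e₁ ≫ 𝔖.iotaLog.app o.fst ≫ eqToHom e₂.symm

/-- The object equalities quantified in `LogPinned` hold (by `rfl`), so its `∀ e₁ e₂` clauses are
not vacuous. [cite: MochizukiAbsTopIII2015, Cor 3.7 (iii) p.88] -/
theorem logPinned_objEqs (n : ℤ) (x : X) (o : 𝔖.Sq) :
    (𝔖.logObsDiagram.pathFunctor timesPairLeft).obj x = 𝔖.lamTimes.obj x ∧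
    (𝔖.logObsDiagram.pathFunctor timesPairRight).obj x = 𝔖.lamTimesPf.obj x ∧
    (𝔖.logObsDiagram.pathFunctor (logPairLeft n)).obj o = 𝔖.lamTimes.obj (𝔖.log.obj o.fst) ∧
    (𝔖.logObsDiagram.pathFunctor (logPairRight n)).obj o = 𝔖.lamTimesPf.obj o.fst := by
  refine ⟨?_, ?_, ?_, ?_⟩ <;>
    simp only [timesPairLeft, timesPairRight, logPairLeft, logPairRight, pathFunctor_cons,
      pathFunctor_nil, Functor.comp_obj, Functor.id_obj] <;> rfl

/-- The observable `𝔖†_log = (𝒟†_{≤3}, v = 𝒩, ℋ)` on `𝒟†_{≤2}` determined by a family `ℋ` on `𝒟†_{≤3}`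
whose boundary paths end at `𝒩`. [cite: MochizukiAbsTopIII2015, Cor 3.7 (iii) p.88] -/
def logObs (H : 𝔖.logObsDiagram.HomotopyFamily)
    (hH : ∀ ⦃a b : logObsShape.{u}.Vertex⦄ ⦃p q : Path a b⦄, H.E p q → b = logObsShape.{u}.obs) :
    (𝔖.daggerLe 2).Observable where
  shape := logObsShape
  isEmpty_J _ := inferInstanceAs (IsEmpty PEmpty)
  ext := 𝔖.logObsExt
  H := H
  terminal_obs := hH

/-- **Cor 3.7 (iii)**: "these natural transformations `ι_{log,⋎}`, `ι_×` belong to a family of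
homotopies on `𝒟†_{≤3}` that determines on `𝒟†_{≤3}` a structure of observable `𝔖†_log` on `𝒟†_{≤2}`":
a family on `𝒟†_{≤3}` generated by `LogGen` with `ι_{log,⋎}`, `ι_×` on the generators, whose boundary
paths end at `𝒩` (`logObs` is then `𝔖†_log`). NOT typed: "compatible with the families [...] of (i),
(ii)". Per-setting `Prop`. [cite: MochizukiAbsTopIII2015, Cor 3.7 (iii) p.88] -/
def ObservableLogStmt : Prop :=
  ∃ H : 𝔖.logObsDiagram.HomotopyFamily, HomotopyFamily.IsGeneratedBy _ H LogGen.{u} ∧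
    (∀ ⦃a b : logObsShape.{u}.Vertex⦄ ⦃p q : Path a b⦄, H.E p q → b = logObsShape.{u}.obs) ∧
    𝔖.LogPinned H

/-! ## Cor 3.7 (iv), first incompatibility -/

/-- **Cor 3.7 (iv), first sentence**: "The diagram of categories `𝒟†_{≤2}` does not admit a structure
of core on `𝒟†_{≤1}` which [...] is compatible with [...] the observable `𝔖†_log` of (iii)" — typed
(the reading of abc-iut-L4-t2/t5 for Cor 3.6 (iv), which implies the printed one): NO family of
homotopies on `𝒟†_{≤3}` contains, for every `⋎`, an isomorphism for the co-verticial pair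
`([pr_{⋎+1}], [pr_⋎]∘[log_𝒳])` (the `ζ₀` of the proof, p. 81) together with the pinned `𝔖†_log`
homotopies. Per-setting `Prop` (for the MLF setting it follows from Lemma 3.4 via
`BiAnabelianSetting.LogCoreKernel`). [cite: MochizukiAbsTopIII2015, Cor 3.7 (iv) p.88] -/
def IncompatibleStmt : Prop :=
  ¬ ∃ K : 𝔖.logObsDiagram.HomotopyFamily,
      (∀ n : ℤ, ∃ h₀ : K.E (corePathPr n) (corePathLog n), IsIso (K.η h₀)) ∧ 𝔖.LogPinned K

end BiAnabelianSetting

end Literature.AnabelianGeometry.AbsoluteAnabelian.AbsTopIII
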